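import Literature.NumberTheory.EllipticCurves.CyclotomicZpExtensionLayerTorsionProofs
import Literature.NumberTheory.EllipticCurves.GreenbergSelmer
import Literature.NumberTheory.GaloisRepresentations.IntegralGaloisActionProofs
import Literature.NumberTheory.GaloisRepresentations.DecompositionGroupOfCompletion
import Mathlib.NumberTheory.Padics.HeightOneSpectrum
import HarnessLib

/-!
# Primes that split completely in a layer of the cyclotomic `ℤ_p`-extension of `ℚ` satisfy
# `q^{p-1} ≡ 1 (mod p^{n+1})` (proofs only: no definition, no named fact)

`Proofs` file in topic `NumberTheory/EllipticCurves`, next to `CyclotomicZpExtensionLayerTorsionProofs`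
(seat `bsd-potss-conjA-anchor` g18; the arithmetic form of hypothesis (c3′) of
`CoatesSujatha2005.conjA_of_homTrivial_layer'`, file `FineSelmerLayerCriterionRat`).

For an odd prime `p`, a cyclotomic `ℤ_p`-extension `κ` of `ℚ` (`ZpExtension.IsCyclotomic`; its `n`-th layer
`ℚ_n` is the fixed field of `κ.layerSubgroup n = κ⁻¹(pⁿℤ_p)`, of degree `pⁿ`, and `ℚ_n ⊂ ℚ(μ_{p^{n+1}})` is the
fixed field of `Δ = {b : b^{p-1} = 1} ≤ (ℤ/p^{n+1})ˣ`, Washington §13.1) and a rational prime `q ≠ p` with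
place `u`:

* `GreenbergSelmer.exists_mem_decomp_isArithFrobAt_adicCompletionPrime` — (any number field `K`, any finite
  place `v`) the chosen decomposition group `D_v ≤ Γ_K` (`GreenbergSelmer.decomp v`, the decomposition group of
  the prime `𝔓₀ = adicCompletionPrime K v` of `\bar ℤ_K`) contains an arithmetic Frobenius at `𝔓₀`
  (Neukirch I §9: Frobenius elements lie in the decomposition group of their prime).
* `ZpExtension.IsCyclotomic.natGenerator_pow_eq_one_of_decomp_le_layerSubgroup` — **if `D_u ≤ Gal(ℚ̄/ℚ_n)`
  (i.e. `q` splits completely in `ℚ_n`) then `q^{p-1} = 1` in `ℤ/p^{n+1}`**: a Frobenius `σ_q ∈ D_u` has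
  mod-`p^{n+1}` cyclotomic character `χ(σ_q) = q` (`modNCyclotomicCharacter_eq_residueCard_of_isArithFrobAt`)
  and `χ(Gal(ℚ̄/ℚ_n)) ⊆ Δ` (`IsCyclotomic.modNCyclotomicCharacter_pow_eq_one_of_mem_layerSubgroup`).  This is
  the direction "`q` splits completely in the fixed field `L` of `H ≤ (ℤ/m)ˣ` ⇒ `q̄ ∈ H`" of Marcus, *Number
  Fields*, Ch. 4 Exercise 12(a) / Ch. 7 (proof of Cor. 3 of Thm. 43), for `m = p^{n+1}`, `H = Δ`, `L = ℚ_n`.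
* `ZpExtension.IsCyclotomic.not_decomp_le_layerSubgroup_succ_of_pow_mod_ne_one` (and the place-indexed form
  `…_of_natCast_mem`) — the contrapositive at the layer `n + 1` in the numeric currency of the record lanes:
  **`q^{p-1} % p^{n+2} ≠ 1 ⇒ ¬ (D_u ≤ κ.layerSubgroup (n+1))`** ("`q` does not split completely in `ℚ_{n+1}`"),
  the first disjunct of hypothesis `hbad` of `CoatesSujatha2005.conjA_of_homTrivial_layer'`.  At `p = 3`,
  `n = 0` this reads `q² ≢ 1 (mod 9)`, i.e. `q ≢ ±1 (mod 9)`.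

Only `p` odd (the layer lemma used is stated for odd `p`; `-- TODO(general form): p = 2`).  HONEST FRAMING:
theorems only; nothing about BSD is claimed.

## References

* [Washington1997] L. C. Washington, *Introduction to Cyclotomic Fields*, 2nd ed. (1997), §13.1 (`ℚ_n ⊂
  ℚ(ζ_{p^{n+1}})` is the fixed field of `Δ`).
* [Marcus2018] D. A. Marcus, *Number Fields*, 2nd ed. (2018), Ch. 4 Exercise 12(a) (for `q ∤ m` and `K ⊂ ℚ(ζ_m)`
  the fixed field of `H ≤ (ℤ/m)ˣ`, the inertial degree of `q` in `K` is the order of `q̄` modulo `H`) and Ch. 7,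
  proof of Cor. 3 of Thm. 43 ("for `p` not dividing `m`, `p` splits completely in `L` iff `p̄ ∈ H`").
* [NeukirchANT1999] J. Neukirch, *Algebraic Number Theory* (1999), Ch. I §9 (Frobenius elements, (9.4)–(9.6)).
-/

set_option autoImplicit false

noncomputable section

open scoped NumberField
open Field NumberField IsDedekindDomain
open Literature.NumberTheory.GaloisRepresentations Literature.NumberTheory.EllipticCurves

universe u

/-! ## §1 A Frobenius in the chosen decomposition group -/

namespace Literature.NumberTheory.EllipticCurves.GreenbergSelmer

variable {K : Type u} [Field K] [NumberField K]

/-- **The chosen decomposition group `D_v` contains an arithmetic Frobenius at the chosen prime `𝔓₀`.**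
For a finite place `v` of a number field `K`, with `𝔓₀ = adicCompletionPrime K v` the prime of `\bar ℤ_K`
cut out by the chosen embedding `K̄ → \bar K_v` (so that `D_v = D_{𝔓₀}`,
`decompositionSubgroup_adicCompletionPrime_eq_range`), there is `σ ∈ D_v` with `σ x ≡ x^{N v} (mod 𝔓₀)`
for all `x ∈ \bar ℤ_K`: Frobenius elements exist (`exists_isArithFrobAt_of_mem_primesAbove_holds`) and
stabilise their prime (Mathlib `IsArithFrobAt.mem_stabilizer`).
[cite: NeukirchANT1999, Ch. I §9 Prop. (9.4) and (9.6)] -/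
theorem exists_mem_decomp_isArithFrobAt_adicCompletionPrime (v : HeightOneSpectrum (𝓞 K)) :
    ∃ σ ∈ decomp v, IsArithFrobAt (𝓞 K) σ (adicCompletionPrime K v) := by
  haveI := adicCompletionPrime_isMaximal K v
  obtain ⟨σ, hσ⟩ := HeightOneSpectrum.exists_isArithFrobAt_of_mem_primesAbove_holds
    (adicCompletionPrime_mem_primesAbove K v)
  refine ⟨σ, ?_, hσ⟩
  show σ ∈ (absGaloisRestrict K (v.adicCompletion K)).toMonoidHom.range
  rw [← decompositionSubgroup_adicCompletionPrime_eq_range]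
  exact hσ.mem_stabilizer

end Literature.NumberTheory.EllipticCurves.GreenbergSelmer

/-! ## §2 Split primes in the layers of the cyclotomic `ℤ_p`-extension of `ℚ` -/

namespace Literature.NumberTheory.EllipticCurves.ZpExtension.IsCyclotomic

open Rat.HeightOneSpectrum

variable {p : ℕ} [Fact p.Prime]

/-- `N u = q_u` for a finite place `u` of `ℚ` (`q_u = natGenerator u` the rational prime under `u`); a local
copy of `Rat.residueCard_eq_natGenerator` (`HeckeCharacterProofs`) to keep the imports light. [folklore] -/
private theorem residueCard_eq_natGenerator (u : HeightOneSpectrum (𝓞 ℚ)) :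
    u.residueCard = natGenerator u := by
  have h : Ideal.span {(natGenerator u : ℤ)} =
      u.asIdeal.map (Rat.IsIntegralClosure.intEquiv (𝓞 ℚ) : 𝓞 ℚ →+* ℤ) := span_natGenerator u
  rw [u.residueCard_eq_card_quotient, Nat.card_congr ((Ideal.quotientEquiv _ _
    (Rat.IsIntegralClosure.intEquiv (𝓞 ℚ)) h).trans (Int.quotientSpanNatEquivZMod _)).toEquiv,
    Nat.card_zmod]

/-- The rational prime under a place `u` of `ℚ` containing the prime number `q` is `q`. [folklore] -/
private theorem natGenerator_eq_of_natCast_mem {u : HeightOneSpectrum (𝓞 ℚ)} {q : ℕ} (hq : q.Prime)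
    (hqu : (q : 𝓞 ℚ) ∈ u.asIdeal) : natGenerator u = q := by
  have h1 : ((q : ℕ) : ℤ) ∈ u.asIdeal.map (Rat.IsIntegralClosure.intEquiv (𝓞 ℚ)) := by
    have := Ideal.mem_map_of_mem (Rat.IsIntegralClosure.intEquiv (𝓞 ℚ)) hqu
    rwa [map_natCast] at this
  exact (Nat.prime_dvd_prime_iff_eq (prime_natGenerator u) hq).mp ((natGenerator_dvd_iff u).mpr h1)

/-- **A prime that splits completely in the `n`-th layer of the cyclotomic `ℤ_p`-extension of `ℚ` satisfies
`q^{p-1} ≡ 1 (mod p^{n+1})`** (`p` odd).  For a cyclotomic `κ : ZpExtension ℚ p` and a place `u` of `ℚ` with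
rational prime `q = q_u ≠ p`: if the decomposition group `D_u` (`GreenbergSelmer.decomp u`) is contained in
`κ.layerSubgroup n = Gal(ℚ̄/ℚ_n)`, then `q^{p-1} = 1` in `ℤ/p^{n+1}`.  Proof: a Frobenius `σ_q ∈ D_u`
(`exists_mem_decomp_isArithFrobAt_adicCompletionPrime`) has mod-`p^{n+1}` cyclotomic character `q`
(`modNCyclotomicCharacter_eq_residueCard_of_isArithFrobAt`), and the mod-`p^{n+1}` cyclotomic character of
`Gal(ℚ̄/ℚ_n)` is `(p-1)`-torsion (`modNCyclotomicCharacter_pow_eq_one_of_mem_layerSubgroup`, Washington §13.1: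
`Gal(ℚ(ζ_{p^{n+1}})/ℚ_n) = Δ`).  This is "`q` splits completely in the fixed field of `H` ⇒ `q̄ ∈ H`" for
`H = Δ ≤ (ℤ/p^{n+1})ˣ`.
[cite: Marcus2018, Ch. 4 Exercise 12(a); Ch. 7, proof of Cor. 3 of Thm. 43] [cite: Washington1997, §13.1] -/
theorem natGenerator_pow_eq_one_of_decomp_le_layerSubgroup {κ : ZpExtension ℚ p} (hκ : κ.IsCyclotomic)
    (hp : p ≠ 2) (n : ℕ) {u : HeightOneSpectrum (𝓞 ℚ)} (hu : natGenerator u ≠ p)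
    (h : GreenbergSelmer.decomp u ≤ κ.layerSubgroup n) :
    ((natGenerator u : ℕ) : ZMod (p ^ (n + 1))) ^ (p - 1) = 1 := by
  have hpp : p.Prime := Fact.out
  haveI : NeZero (p ^ (n + 1)) := ⟨pow_ne_zero _ hpp.ne_zero⟩
  obtain ⟨σ, hσD, hσ⟩ := GreenbergSelmer.exists_mem_decomp_isArithFrobAt_adicCompletionPrime u
  -- `χ(σ)^{p-1} = 1` since `σ ∈ D_u ≤ Gal(ℚ̄/ℚ_n)`
  have h1 := hκ.modNCyclotomicCharacter_pow_eq_one_of_mem_layerSubgroup hp n rfl (h hσD)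
  -- `p^{n+1} ∉ 𝔓₀` because `q_u ≠ p`
  have hN : ((p ^ (n + 1) : ℕ) : absIntegers (𝓞 ℚ) ℚ) ∉ adicCompletionPrime ℚ u := by
    refine Rat.natCast_not_mem_of_mem_primesAbove_of_not_dvd (adicCompletionPrime_mem_primesAbove ℚ u) ?_
    intro hdvd
    have hdvd' : natGenerator u ∣ p ^ (n + 1) := hdvd
    exact hu ((Nat.prime_dvd_prime_iff_eq (prime_natGenerator u) hpp).mp
      ((prime_natGenerator u).dvd_of_dvd_pow hdvd'))
  -- `χ(σ) = N u = q_u`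
  have h2 := modNCyclotomicCharacter_eq_residueCard_of_isArithFrobAt
    (adicCompletionPrime_mem_primesAbove ℚ u) hN hσ
  rw [residueCard_eq_natGenerator] at h2
  have h3 := congrArg (fun x : (ZMod (p ^ (n + 1)))ˣ => (x : ZMod (p ^ (n + 1)))) h1
  simp only [Units.val_pow_eq_pow_val, Units.val_one, h2] at h3
  exact h3

/-- **`q^{p-1} % p^{n+2} ≠ 1` ⇒ `q` does not split completely in `ℚ_{n+1}`** (`p` odd, `q = q_u ≠ p`): the
decomposition group `D_u` is NOT contained in `κ.layerSubgroup (n + 1) = Gal(ℚ̄/ℚ_{n+1})` — the first disjunct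
of hypothesis `hbad` of `CoatesSujatha2005.conjA_of_homTrivial_layer'` (file `FineSelmerLayerCriterionRat`).
At `p = 3`, `n = 0`: `q² ≢ 1 (mod 9)`, i.e. `q ≢ ±1 (mod 9)`.
[cite: Marcus2018, Ch. 4 Exercise 12(a); Ch. 7, proof of Cor. 3 of Thm. 43] [cite: Washington1997, §13.1] -/
theorem not_decomp_le_layerSubgroup_succ_of_pow_mod_ne_one {κ : ZpExtension ℚ p} (hκ : κ.IsCyclotomic)
    (hp : p ≠ 2) (n : ℕ) {u : HeightOneSpectrum (𝓞 ℚ)} {q : ℕ} (hq : natGenerator u = q) (hqp : q ≠ p)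
    (hmod : q ^ (p - 1) % p ^ (n + 2) ≠ 1) :
    ¬ (GreenbergSelmer.decomp u ≤ κ.layerSubgroup (n + 1)) := by
  have hpp : p.Prime := Fact.out
  intro h
  subst hq
  have h1 := natGenerator_pow_eq_one_of_decomp_le_layerSubgroup hκ hp (n + 1) hqp h
  apply hmod
  have h2 : ((natGenerator u ^ (p - 1) : ℕ) : ZMod (p ^ (n + 2))) = ((1 : ℕ) : ZMod (p ^ (n + 2))) := by
    rw [Nat.cast_pow, Nat.cast_one]
    exact h1
  rw [ZMod.natCast_eq_natCast_iff'] at h2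
  have hlt : 1 < p ^ (n + 2) := Nat.one_lt_pow (by omega) hpp.one_lt
  rw [h2]
  exact Nat.mod_eq_of_lt hlt

/-- The same with the place `u` specified by a prime number `q` it contains (`(q : 𝓞 ℚ) ∈ u.asIdeal`, the
currency of `CoatesSujatha2005.conjA_of_homTrivial_layer'` for the place above `p`): **`q` prime, `q ≠ p`,
`q^{p-1} % p^{n+2} ≠ 1` ⇒ `¬ (D_u ≤ κ.layerSubgroup (n + 1))`.**
[cite: Marcus2018, Ch. 4 Exercise 12(a); Ch. 7, proof of Cor. 3 of Thm. 43] [cite: Washington1997, §13.1] -/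
theorem not_decomp_le_layerSubgroup_succ_of_natCast_mem {κ : ZpExtension ℚ p} (hκ : κ.IsCyclotomic)
    (hp : p ≠ 2) (n : ℕ) {u : HeightOneSpectrum (𝓞 ℚ)} {q : ℕ} (hq : q.Prime)
    (hqu : (q : 𝓞 ℚ) ∈ u.asIdeal) (hqp : q ≠ p) (hmod : q ^ (p - 1) % p ^ (n + 2) ≠ 1) :
    ¬ (GreenbergSelmer.decomp u ≤ κ.layerSubgroup (n + 1)) :=
  not_decomp_le_layerSubgroup_succ_of_pow_mod_ne_one hκ hp n (natGenerator_eq_of_natCast_mem hq hqu)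
    hqp hmod

-- TODO(general form): `p = 2` (`ℚ_n ⊂ ℚ(μ_{2^{n+2}})`, `Δ = {±1}`), the converse direction
-- (`q^{p-1} ≡ 1 (mod p^{n+1})` ⇒ `q` splits completely in `ℚ_n`), and a general base field.

end Literature.NumberTheory.EllipticCurves.ZpExtension.IsCyclotomic

end
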